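import Summits.CriticalPhenomena.PercolationContinuityZ3.Theorems.PercLowPointHalfSpaceTallClusterMassBoundArrowOneLogRatio
import Summits.CriticalPhenomena.PercolationContinuityZ3.Theorems.PercLowPointHalfSpaceTallClusterMassBoundStubFirstMomentTransfer

/-!
# `TallClusterMassBound` (stmt-CriticalPhenomena-0912), line `SketchIdeator4` — ARROW 1 sharpened, canonical form:
# the logarithm is `log⁺` of a VOLUME-versus-RADIUS ratio of the wall cluster

Helper stubs of the skeleton `Cruxes/TallClusterMassBound/Lines/SketchIdeator4.lean`
(crux `…Theses.PercLowPointHalfSpace.TallClusterMassBound`, item B of route PercLowPointHalfSpace), continuing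
`…ArrowOneLogRatio.lean` (`mass_le_typicalMax_mul_log_ratio`: for every `p`, `r`,
`M_p(r) ≤ (2 + 3e^{3/2}) · M · π · (1 + log⁺(q/π))`, `M = typicalMax P^ℍ_p Λ_r`, `π = π_p(r)`,
`q = P^ℍ_p(|K_0 ∩ Λ_r| ≥ M)`).

Since `{|K_0 ∩ Λ_r| ≥ M} ⊆ {|C_ℍ(0)| ≥ M}` (and conversely `{|C_ℍ(0)| ≥ M} ⊆ {|K_0 ∩ Λ_r| ≥ M} ∪ arm_ℍ(0,r)`, a cluster
that does not reach sup-distance `r` lies inside `Λ_r`), the ratio `q/π` is, up to `±1`, the ratio of the VOLUME tail of the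
wall cluster at the typical maximum of scale `r` to its RADIUS tail at `r`:

  `V(r) := P_{p_c}(|C_ℍ(0)| ≥ M(Λ_r)) / π_s(r)`.

* `massBoundAt_of_typicalMax_le_of_rootRatio` — `typicalMax ≤ C r^s` and `q ≤ K π` (all `r ≥ 1`) give `MassBoundAt p_c s`
  with the SAME exponent;
* `tallClusterMassBound_of_squareSubharmonic_of_volRad` — **B ⟸ `SquareSubharmonic` (stmt-11506, verbatim) ∧ `V` bounded.**

`V` bounded ("volume ≥ M(Λ_r) is at most `K` times as likely as radius ≥ r, for the cluster of a wall point") is one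
direction of HYPERSCALING for wall clusters (heuristically both tails are `≍ r^{-x_s}`: volume-tail exponent `x_s/d_f`
evaluated at `M ≍ r^{d_f}`); it is implied by the susceptibility-ratio hypothesis of `…_of_chiRatio` (Markov,
`real_typicalMax_le_clusterCapIn_le_chiH_div`) and is therefore the weaker — canonical — form of what separates B
(`m = 11/4` exactly) from the landed `B_all ⟸ SquareSubharmonic` (`massBoundAt_of_squareSubharmonic`, every `m > 11/4`).
It is not an existing item and no engine for it is known (a proof along scales needs growth of `r ↦ M(Λ_r)` and
short-range doubling of `π_s`). No definitions; no criticality enters §1.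
-/

noncomputable section

open MeasureTheory Finset Filter
open Literature.Probability.Percolation Literature.Probability.LatticeModels
open Summit.CriticalPhenomena.PercolationContinuityZ3.Theses.PercLowPointHalfSpace (TallClusterMassBound)
open Summit.CriticalPhenomena.PercolationContinuityZ3.Theses.PercSubharmonicSquare (SquareSubharmonic)
open Summit.CriticalPhenomena.PercolationContinuityZ3.Theorems.TallClusterMassBound.Negative

namespace Summit.CriticalPhenomena.PercolationContinuityZ3.Theorems.TallClusterMassBound.TightnessLine

/-! ## §1 Every `p`: the root factor against the volume tail of the wall cluster -/

/-- `q = P^ℍ_p(|K_0 ∩ Λ_r| ≥ M) ≤ P^ℍ_p(|C_ℍ(0)| ≥ M)` for every threshold `M` (`|K_0 ∩ Λ_r| ≤ |K_0|`). [folklore] -/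
theorem real_le_clusterCapIn_le_real_clusterSizeGe (p : unitInterval) (r n : ℕ) :
    (floorDilutedPercolation 3 p 1).real {ω | n ≤ clusterCapIn (halfBox r) ω 0} ≤
      (floorDilutedPercolation 3 p 1).real (clusterSizeGe (0 : V3) n) :=
  measureReal_mono (StubHyperscaling.setOf_le_clusterCapIn_subset_clusterSizeGe (halfBox r) 0 n)
    (measure_ne_top _ _)

/-- **ARROW 1 at every `p`, volume-tail form**:
`M_p(r) ≤ (2 + 3e^{3/2}) · M · π_p(r) · (1 + log⁺(P^ℍ_p(|C_ℍ(0)| ≥ M) / π_p(r)))`, `M = typicalMax P^ℍ_p Λ_r`. [folklore] -/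
theorem mass_le_typicalMax_mul_log_volRatio (p : unitInterval) (r : ℕ) :
    mass p r ≤ (2 + 3 * Real.exp (3 / 2)) *
      (typicalMax (floorDilutedPercolation 3 p 1) (halfBox r) : ℝ) * armProb p r *
        (1 + max 0 (Real.log ((floorDilutedPercolation 3 p 1).real
          (clusterSizeGe (0 : V3) (typicalMax (floorDilutedPercolation 3 p 1) (halfBox r))) / armProb p r))) := by
  refine (mass_le_typicalMax_mul_log_ratio p r).trans ?_
  set μ := floorDilutedPercolation 3 p 1 with hμ
  set M := typicalMax μ (halfBox r) with hMdef
  set π := armProb p r with hπdef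
  set q := μ.real {ω | M ≤ clusterCapIn (halfBox r) ω 0} with hqdef
  set v := μ.real (clusterSizeGe (0 : V3) M) with hvdef
  have hπ0 : 0 ≤ π := armProb_nonneg p r
  have hq0 : 0 ≤ q := measureReal_nonneg
  have hqv : q ≤ v := real_le_clusterCapIn_le_real_clusterSizeGe p r M
  have hratio : q / π ≤ v / π := by
    rcases hπ0.eq_or_lt with hπz | hπpos
    · rw [← hπz, div_zero, div_zero]
    · exact div_le_div_of_nonneg_right hqv hπpos.le
  have hlog : max 0 (Real.log (q / π)) ≤ max 0 (Real.log (v / π)) :=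
    Real.posLog_le_posLog (div_nonneg hq0 hπ0) hratio
  have hK : 0 ≤ (2 + 3 * Real.exp (3 / 2)) * (M : ℝ) * π := by positivity
  have h1 : 1 + max 0 (Real.log (q / π)) ≤ 1 + max 0 (Real.log (v / π)) := by linarith
  exact mul_le_mul_of_nonneg_left h1 hK

/-! ## §2 At `p_c`: a bounded root ratio removes the logarithm -/

/-- **No-loss arithmetic, root-ratio form**: `typicalMax P^ℍ_{p_c} Λ_r ≤ C r^s` and
`q(r) = P^ℍ_{p_c}(|K_0 ∩ Λ_r| ≥ typicalMax) ≤ K · π_{p_c}(r)` (all `r ≥ 1`) give `MassBoundAt p_c s` with the SAME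
exponent `s` (constant `(2 + 3e^{3/2})(1 + log⁺ K) max(C,0)`). [folklore] -/
theorem massBoundAt_of_typicalMax_le_of_rootRatio :
    ∀ (s C K : ℝ), (∀ r : ℕ, 1 ≤ r → (typicalMax (floorDilutedPercolation 3 (criticalProbI 3) 1) (halfBox r) : ℝ) ≤ C * (r : ℝ) ^ s) → (∀ r : ℕ, 1 ≤ r → (floorDilutedPercolation 3 (criticalProbI 3) 1).real {ω | typicalMax (floorDilutedPercolation 3 (criticalProbI 3) 1) (halfBox r) ≤ clusterCapIn (halfBox r) ω 0} ≤ K * armProb (criticalProbI 3) r) → MassBoundAt (criticalProbI 3) s := by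
  intro s C K hM hq
  refine ⟨(2 + 3 * Real.exp (3 / 2)) * (1 + max 0 (Real.log K)) * max C 0, fun r hr => ?_⟩
  set μ := floorDilutedPercolation 3 (criticalProbI 3) 1 with hμ
  set M := (typicalMax μ (halfBox r) : ℝ) with hMdef
  set π := armProb (criticalProbI 3) r with hπdef
  set q := μ.real {ω | typicalMax μ (halfBox r) ≤ clusterCapIn (halfBox r) ω 0} with hqdef
  have hπ : 0 < π := armProb_criticalProbI_pos r
  have hM2 : (2 : ℝ) ≤ M := by
    rw [hMdef]
    exact_mod_cast two_le_typicalMax _ (halfBox_nonempty r)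
  have hM0 : 0 < M := by linarith
  have hq0 : 0 ≤ q := measureReal_nonneg
  have hratio : q / π ≤ K := by
    rw [div_le_iff₀ hπ]
    exact hq r hr
  have hlog : max 0 (Real.log (q / π)) ≤ max 0 (Real.log K) :=
    Real.posLog_le_posLog (div_nonneg hq0 hπ.le) hratio
  have hL0 : 0 ≤ max 0 (Real.log K) := le_max_left _ _
  have hr0 : (0 : ℝ) < r := by exact_mod_cast hr
  have hrs : 0 ≤ (r : ℝ) ^ s := Real.rpow_nonneg hr0.le s
  have hMC : M ≤ max C 0 * (r : ℝ) ^ s := (hM r hr).trans (mul_le_mul_of_nonneg_right (le_max_left _ _) hrs)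
  calc mass (criticalProbI 3) r
      ≤ (2 + 3 * Real.exp (3 / 2)) * M * π * (1 + max 0 (Real.log (q / π))) :=
        mass_le_typicalMax_mul_log_ratio (criticalProbI 3) r
    _ ≤ (2 + 3 * Real.exp (3 / 2)) * M * π * (1 + max 0 (Real.log K)) := by gcongr
    _ = (2 + 3 * Real.exp (3 / 2)) * (1 + max 0 (Real.log K)) * M * π := by ring
    _ ≤ (2 + 3 * Real.exp (3 / 2)) * (1 + max 0 (Real.log K)) * (max C 0 * (r : ℝ) ^ s) * π := by gcongr
    _ = (2 + 3 * Real.exp (3 / 2)) * (1 + max 0 (Real.log K)) * max C 0 * (r : ℝ) ^ s * π := by ring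

/-- **B ⟸ `SquareSubharmonic` (stmt-CriticalPhenomena-11506, verbatim) ∧ a bounded volume-versus-radius ratio of the wall
cluster `P^ℍ_{p_c}(|C_ℍ(0)| ≥ typicalMax P^ℍ_{p_c} Λ_r) ≤ K · π_{p_c}(r)`**: `SquareSubharmonic` gives
`typicalMax ≤ C' r^{11/4}` exactly (`tau_criticalProbI_le_of_subharmonicPower` at `s = 2`, ball sums at rate `a = 1/2`,
ENGINE 4), and the bounded ratio removes the logarithm of ARROW 1 (`massBoundAt_of_typicalMax_le_of_rootRatio` with
`q ≤ P^ℍ(|C_ℍ(0)| ≥ M)`). [folklore] -/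
theorem tallClusterMassBound_of_squareSubharmonic_of_volRad :
    Summit.CriticalPhenomena.PercolationContinuityZ3.Theses.PercSubharmonicSquare.SquareSubharmonic → (∃ K : ℝ, ∀ r : ℕ, 1 ≤ r → (floorDilutedPercolation 3 (criticalProbI 3) 1).real (clusterSizeGe (0 : V3) (typicalMax (floorDilutedPercolation 3 (criticalProbI 3) 1) (halfBox r))) ≤ K * armProb (criticalProbI 3) r) → Summit.CriticalPhenomena.PercolationContinuityZ3.Theses.PercLowPointHalfSpace.TallClusterMassBound := by
  intro h hV
  obtain ⟨K, hK⟩ := hV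
  obtain ⟨R, hR⟩ := h
  -- `SquareSubharmonic` is sub-mean-value of `τ_p^s` with the real exponent `s = 2`
  have hsub : ∀ p : unitInterval, (p : ℝ) < criticalProb (zdGraph 3) (0 : Site 3) →
      ∀ x : Site 3, (R : ℝ) < ‖x‖ →
        tau 3 p 0 x ^ (2 : ℝ) ≤
          (1 / 6 : ℝ) * ∑ i : Fin 3, (tau 3 p 0 (x + Pi.single i 1) ^ (2 : ℝ) + tau 3 p 0 (x - Pi.single i 1) ^ (2 : ℝ)) := by
    intro p hp x hx
    simpa only [Real.rpow_two] using hR p hp x hx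
  obtain ⟨C, hC0, hC⟩ := tau_criticalProbI_le_of_subharmonicPower (s := 2) (by norm_num) hsub
  have hpt : ∀ x : Site 3, x ≠ 0 → tau 3 (criticalProbI 3) 0 x ≤ C * ‖x‖ ^ (-((1 : ℝ) / 2)) := by
    intro x hx
    simpa using hC x hx
  have hball := ballSum_le_of_pointwise (a := 1 / 2) (by norm_num) hC0.le hpt
  obtain ⟨C', hC'⟩ := typicalMax_le_of_ballTwoPointDecay (a := 1 / 2) (by norm_num) hball
  refine tallClusterMassBound_iff.2 (massBoundAt_of_typicalMax_le_of_rootRatio ((11 : ℝ) / 4) C' K ?_ ?_)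
  · intro r hr
    have e : ((6 : ℝ) - 1 / 2) / 2 = (11 : ℝ) / 4 := by norm_num
    rw [← e]
    exact hC' r hr
  · intro r hr
    exact (real_le_clusterCapIn_le_real_clusterSizeGe (criticalProbI 3) r _).trans (hK r hr)

/-! ## §3 The converse inclusion: `V ≤ q/π + 1` (appended by lead c3) -/

/-- **Surely, off the arm event a large wall cluster sits inside the half-box**: for a configuration supported on half-space
edges, `|C_ℍ(0)| ≥ n` and `ω ∉ arm_ℍ(0,r)` force `|K_0 ∩ Λ_r| ≥ n` (every vertex of the cluster is joined to `0` inside `ℍ`, hence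
has sup-norm `< r` off the arm event, hence lies in `Λ_r = halfBox r`). [folklore] -/
theorem le_clusterCapIn_of_clusterSizeGe_of_not_arm {ω : BondConfig V3} (hω : ω ⊆ halfSpaceEdgeSet 3) {r n : ℕ}
    (hsize : ω ∈ clusterSizeGe (0 : V3) n) (harm : ω ∉ arm r) : n ≤ clusterCapIn (halfBox r) ω 0 := by
  classical
  have hsub : openCluster ω 0 ⊆ ↑((halfBox r).filter fun z => (openGraph ω).Reachable 0 z) := by
    intro z hz
    have hreach : (openGraph ω).Reachable 0 z := hz
    have hconn : ω ∈ openConnIn Hs 0 z := mem_openConnIn_Hs_of_mem_openConn hω zero_mem_Hs hreach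
    have hzH : z ∈ Hs := hconn.2.1
    have hnear : ¬ ∃ i : Fin 3, (r : ℤ) ≤ |z i| := fun hfar => harm ⟨z, hfar, hconn⟩
    push Not at hnear
    have hzbox : z ∈ box 3 r := by
      rw [mem_box]
      intro i
      have hi := hnear i
      rw [abs_lt] at hi
      constructor <;> omega
    rw [Finset.coe_filter]
    exact ⟨by rw [halfBox, Finset.mem_filter]; exact ⟨hzbox, hzH⟩, hreach⟩
  have hfin : (openCluster ω 0).encard ≤ (((halfBox r).filter fun z => (openGraph ω).Reachable 0 z).card : ℕ∞) := by
    rw [← Set.encard_coe_eq_coe_finsetCard]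
    exact Set.encard_mono hsub
  rw [mem_clusterSizeGe] at hsize
  rw [clusterCapIn_eq]
  exact_mod_cast hsize.trans hfin

/-- **`P^ℍ_p(|C_ℍ(0)| ≥ n) ≤ P^ℍ_p(|K_0 ∩ Λ_r| ≥ n) + π_p(r)`** for every `p`, `r`, `n` (a.s. the open edges of `P^ℍ_p` lie in `ℍ`;
`le_clusterCapIn_of_clusterSizeGe_of_not_arm`; bridge `π_p(r) = P^ℍ_p(arm_r)`). With `n = typicalMax P^ℍ_p Λ_r` and
`real_le_clusterCapIn_le_real_clusterSizeGe`: `q ≤ P^ℍ(|C_ℍ(0)| ≥ M) ≤ q + π`, i.e. the volume-versus-radius ratio `V` and the root ratio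
`q/π` of ARROW 1 are bounded together (`V ≤ q/π + 1`). [folklore] -/
theorem real_clusterSizeGe_le_root_add_armProb :
    ∀ (p : unitInterval) (r n : ℕ), (floorDilutedPercolation 3 p 1).real (clusterSizeGe (0 : V3) n) ≤ (floorDilutedPercolation 3 p 1).real {ω | n ≤ clusterCapIn (halfBox r) ω 0} + armProb p r := by
  intro p r n
  rw [armProb_eq_floorDiluted p r]
  set μ := floorDilutedPercolation 3 p 1 with hμ
  have hae : ∀ᵐ ω ∂μ, ω ∈ clusterSizeGe (0 : V3) n → ω ∈ {ω | n ≤ clusterCapIn (halfBox r) ω 0} ∪ arm r := by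
    filter_upwards [floorDilutedPercolation_ae_subset (d := 3) p 1] with ω hω hsize
    by_cases harm : ω ∈ arm r
    · exact Or.inr harm
    · exact Or.inl (le_clusterCapIn_of_clusterSizeGe_of_not_arm hω hsize harm)
  calc μ.real (clusterSizeGe (0 : V3) n)
      ≤ μ.real ({ω | n ≤ clusterCapIn (halfBox r) ω 0} ∪ arm r) := by
        rw [measureReal_def, measureReal_def]
        exact ENNReal.toReal_mono (measure_ne_top _ _) (measure_mono_ae hae)
    _ ≤ μ.real {ω | n ≤ clusterCapIn (halfBox r) ω 0} + μ.real (arm r) := measureReal_union_le _ _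

end Summit.CriticalPhenomena.PercolationContinuityZ3.Theorems.TallClusterMassBound.TightnessLine

end
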